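import Literature.MathematicalPhysics.QuantumFieldTheory.Balaban1983to89.B11SupSize190

/-!
# `Balaban1983to89.B11TracePairing` — the TRACE FORM `⟨A, B⟩ = Σ_b Re Tr A(b)ᴴB(b)` on `U(N)`-matrix-valued bond
# configurations ([Balaban1985Variational] (85), (88)–(90): the scalar products *«with respect to bonds»* under which
# `δ𝔇*`, `𝔇*`, `H*` of the (189) census are TRANSPOSES), and the explicit transpose `Tᵗ` of a real-linear operator —
# the DEFINITIONS (module 3a of the -b₂ transposition chain; the letters and the adjoint identity are module 3b
# `B11TracePairingLetters`)

statement-level skeleton of published theorems with citation tags; proofs where landed; nothing here is a claim about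
the Yang–Mills mass gap.

CITATION HEADER (lean-in-tree rule 2026-08-18).  T. Bałaban, *The variational problem and background fields in
renormalization group method for lattice gauge theories*, Commun. Math. Phys. **102**, 277–309 (1985)
[Balaban1985Variational] (cell paper B11): p. 291 (85) *«⟨(δ/δA′)𝔇(A′)𝔄, HᵀJ⟩»*, (88)–(90) (the transposed kernels `𝔇*`,
`H*`; the scalar products are *«with respect to bonds … in η-scale»*), p. 308 (189)–(190); [Balaban1985Averaging] (19)
p. 21 (the operator norm `|·|` on `U(N)`-matrices = Mathlib's scoped `Matrix.Norms.L2Operator`).  Nothing of the series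
is asserted: this module is finite-dimensional linear algebra (the real Hilbert–Schmidt pairing of complex matrices and the
transpose of a real-linear map) in the vocabulary of `B11SectG` ∕ `B11SupSize190`; the displays are cited as the CONTEXT
whose scalar products these definitions model.

WHY THIS FILE EXISTS (YM-DAG node N07 = [B11], -b₂ seat `pub-ymgap-dag-n21-b` g2, dag-lead [DAGLEAD-G2-REBALANCE-32] on
n07-b's published cut `HOME/pub-ymgap-dag-n07-b/HANDOFF-g0.md`: *«a transpose needs a PAIRING on 𝔸-valued bond
configurations (trace form), absent from the abstract 𝔸 of the C_j files … typable once a pairing is fixed»*).  The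
kernel-lane module `B11Ineq189Transpose` (p416995) transposes majorants under three displayed LETTERS (adjoint identity,
duality of a block size against the pairing, block Hölder).  THIS FILE fixes the pairing and the transpose for the
gauge-field case `𝔸 = Matrix n n ℂ`:
* §1 `trPair A B = Re Tr(AᴴB)` (`trPair_eq_sum`: `= Σ_{ij} Re(conj A_{ij}·B_{ij})`, the real Hilbert–Schmidt pairing;
  `trPair_self_eq_sum_sq`; `ℝ`-bilinearity `trPair_add_left∕right`, `trPair_smul_left∕right`, `trPair_zero_left∕right`,
  `trPair_single_left` (pairing with a matrix unit reads one entry), `trPair_realSmul_left`);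
* §2 `trForm f g = Σ_x trPair (f x) (g x)` on bond configurations `X → Matrix n n ℂ`, its algebra, `trForm_single_left`, and the
  `ℝ`-linear functional `trFormLeft g`;
* §3 **`transposeOf T`** — the transpose of an `ℝ`-linear `T : (X → Matrix n n ℂ) → (Y → Matrix n n ℂ)` for the trace forms,
  ENTRYWISE: `(Tᵗw)(x)_{ij} = ⟨T(δ_xE_{ij}), w⟩ + i·⟨T(δ_x iE_{ij}), w⟩` (`T` is only real-linear, so the two real directions of
  each matrix unit are read separately); `transposeOf_apply∕_add∕_smul`; the family version **`transposeOf₂ Φ`**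
  (`𝔄 ↦ (Φ𝔄)ᵗ`, linear in `𝔄` — the shape of `δ𝔇(A′)[𝔄] ↦ δ𝔇*[𝔄]`).
The THEOREMS about these objects — `‖A‖² ≤ Re Tr AᴴA`, `Re Tr AᴴB ≤ n‖A‖‖B‖`, the duality letter (`C = 1`) and the block
Hölder letter (`N ≥ n·#Δ(y)`) for the sup sizes of (190), and the ADJOINT IDENTITY `⟨Tμ, w⟩ = ⟨μ, Tᵗw⟩` — are module 3b
`B11TracePairingLetters` (kernel lane).

HONEST SCOPE.  Definitions WITH BODIES + their algebra; no `def … : Prop`, no `instance`, no `notation` (Mathlib's scoped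
`Matrix.Norms.L2Operator` instances are opened, not declared); the identification of `T` with Bałaban's `𝔇(A′)`, `H`,
`δ𝔇(A′)[𝔄]` is the consumer's.  0 sorry; axioms standard.  One finite T⁴ programme at fixed `ε` upstream — NOT infinite
volume, NOT OS on ℝ⁴, NOT a mass gap, NOT Clay.
-/

namespace Literature.MathematicalPhysics.QuantumFieldTheory.Balaban1983to89.B11TracePairing

open Finset B11SectG B11SupSize190
open scoped Matrix ComplexConjugate Matrix.Norms.L2Operator

noncomputable section

variable {n : Type} [Fintype n] [DecidableEq n]

/-! ## §1  The real Hilbert–Schmidt pairing of complex matrices -/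

section Pair

/-- `trPair A B = Re Tr(AᴴB)` — the real trace form on `N × N` complex matrices (the pairing of the scalar products of
[Balaban1985Variational] (85), (88)–(90) at one bond). [cite: Balaban1985Variational, (85) p.291] -/
def trPair (A B : Matrix n n ℂ) : ℝ := ((Aᴴ * B).trace).re

omit [DecidableEq n] in
/-- `Re Tr(AᴴB) = Σ_{i,j} Re(conj(A_{ij})·B_{ij})` — the real Hilbert–Schmidt pairing entrywise. [cite: Balaban1985Variational, (85) p.291] -/
theorem trPair_eq_sum (A B : Matrix n n ℂ) : trPair A B = ∑ i, ∑ j, (conj (A i j) * B i j).re := by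
  unfold trPair
  rw [Finset.sum_comm]
  simp only [Matrix.trace, Matrix.diag, Matrix.mul_apply, Matrix.conjTranspose_apply, Complex.re_sum,
    RCLike.star_def]

omit [DecidableEq n] in
/-- `Re Tr(AᴴA) = Σ_{i,j} ‖A_{ij}‖²` (the squared Hilbert–Schmidt norm). [cite: Balaban1985Variational, (85) p.291] -/
theorem trPair_self_eq_sum_sq (A : Matrix n n ℂ) : trPair A A = ∑ i, ∑ j, ‖A i j‖ ^ 2 := by
  rw [trPair_eq_sum]
  refine Finset.sum_congr rfl fun i _ => Finset.sum_congr rfl fun j _ => ?_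
  rw [Complex.conj_mul', ← Complex.ofReal_pow, Complex.ofReal_re]

omit [DecidableEq n] in
/-- `0 ≤ Re Tr(AᴴA)`. [cite: Balaban1985Variational, (85) p.291] -/
theorem trPair_self_nonneg (A : Matrix n n ℂ) : 0 ≤ trPair A A := by
  rw [trPair_self_eq_sum_sq]
  exact Finset.sum_nonneg fun i _ => Finset.sum_nonneg fun j _ => sq_nonneg _

omit [DecidableEq n] in
/-- Additivity in the first argument. [cite: Balaban1985Variational, (85) p.291] -/
theorem trPair_add_left (A A' B : Matrix n n ℂ) : trPair (A + A') B = trPair A B + trPair A' B := by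
  unfold trPair
  rw [Matrix.conjTranspose_add, add_mul, Matrix.trace_add, Complex.add_re]

omit [DecidableEq n] in
/-- Additivity in the second argument. [cite: Balaban1985Variational, (85) p.291] -/
theorem trPair_add_right (A B B' : Matrix n n ℂ) : trPair A (B + B') = trPair A B + trPair A B' := by
  unfold trPair
  rw [mul_add, Matrix.trace_add, Complex.add_re]

omit [DecidableEq n] in
/-- Real homogeneity in the first argument. [cite: Balaban1985Variational, (85) p.291] -/
theorem trPair_smul_left (r : ℝ) (A B : Matrix n n ℂ) : trPair (r • A) B = r * trPair A B := by
  rw [trPair_eq_sum, trPair_eq_sum, Finset.mul_sum]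
  refine Finset.sum_congr rfl fun i _ => ?_
  rw [Finset.mul_sum]
  refine Finset.sum_congr rfl fun j _ => ?_
  rw [Matrix.smul_apply, Complex.real_smul, map_mul, Complex.conj_ofReal, mul_assoc, Complex.re_ofReal_mul]

omit [DecidableEq n] in
/-- Real homogeneity in the second argument. [cite: Balaban1985Variational, (85) p.291] -/
theorem trPair_smul_right (r : ℝ) (A B : Matrix n n ℂ) : trPair A (r • B) = r * trPair A B := by
  rw [trPair_eq_sum, trPair_eq_sum, Finset.mul_sum]
  refine Finset.sum_congr rfl fun i _ => ?_
  rw [Finset.mul_sum]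
  refine Finset.sum_congr rfl fun j _ => ?_
  rw [Matrix.smul_apply, Complex.real_smul, mul_left_comm, Complex.re_ofReal_mul]

omit [DecidableEq n] in
/-- `trPair 0 B = 0`. [cite: Balaban1985Variational, (85) p.291] -/
theorem trPair_zero_left (B : Matrix n n ℂ) : trPair 0 B = 0 := by
  unfold trPair
  rw [Matrix.conjTranspose_zero, zero_mul, Matrix.trace_zero, Complex.zero_re]

omit [DecidableEq n] in
/-- `trPair A 0 = 0`. [cite: Balaban1985Variational, (85) p.291] -/
theorem trPair_zero_right (A : Matrix n n ℂ) : trPair A 0 = 0 := by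
  unfold trPair
  rw [mul_zero, Matrix.trace_zero, Complex.zero_re]

/-- Pairing with a matrix unit reads one entry: `Re Tr((cE_{ij})ᴴB) = Re(conj c·B_{ij})`. [cite: Balaban1985Variational, (85) p.291] -/
theorem trPair_single_left (i j : n) (c : ℂ) (B : Matrix n n ℂ) :
    trPair (Matrix.single i j c) B = (conj c * B i j).re := by
  rw [trPair_eq_sum, Finset.sum_eq_single i, Finset.sum_eq_single j]
  · rw [Matrix.single_apply_same]
  · intro j' _ hj'
    rw [Matrix.single_apply_of_col_ne i i (Ne.symm hj'), map_zero, zero_mul, Complex.zero_re]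
  · intro h; exact absurd (Finset.mem_univ j) h
  · intro i' _ hi'
    refine Finset.sum_eq_zero fun j' _ => ?_
    rw [Matrix.single_apply_of_row_ne (Ne.symm hi'), map_zero, zero_mul, Complex.zero_re]
  · intro h; exact absurd (Finset.mem_univ i) h

omit [DecidableEq n] in
/-- The complex scaling of the first argument by a REAL number written as a complex scalar: `Re Tr((c•A)ᴴA) = c·Re Tr(AᴴA)`
for `c : ℝ` (used to normalise the duality witness). [cite: Balaban1985Variational, (85) p.291] -/
theorem trPair_realSmul_left (c : ℝ) (A B : Matrix n n ℂ) : trPair ((c : ℂ) • A) B = c * trPair A B := by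
  have : (c : ℂ) • A = c • A := by
    ext i j
    rw [Matrix.smul_apply, Matrix.smul_apply, Complex.real_smul, smul_eq_mul]
  rw [this, trPair_smul_left]

end Pair

/-! ## §2  The trace form on bond configurations -/

section Form

variable {X : Type} [Fintype X]

/-- `trForm f g = Σ_x Re Tr f(x)ᴴg(x)` — the trace form of [Balaban1985Variational] (85) ∕ (88)–(90) on `U(N)`-matrix-valued
bond configurations (the `η`-scale weight of print absorbed into the sizes, as in `B11SectG`). [cite: Balaban1985Variational, (85) p.291] -/
def trForm (f g : X → Matrix n n ℂ) : ℝ := ∑ x, trPair (f x) (g x)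

omit [DecidableEq n] in
/-- Additivity in the first argument. [cite: Balaban1985Variational, (85) p.291] -/
theorem trForm_add_left (f f' g : X → Matrix n n ℂ) : trForm (f + f') g = trForm f g + trForm f' g := by
  unfold trForm
  rw [← Finset.sum_add_distrib]
  exact Finset.sum_congr rfl fun x _ => trPair_add_left _ _ _

omit [DecidableEq n] in
/-- Additivity in the second argument. [cite: Balaban1985Variational, (85) p.291] -/
theorem trForm_add_right (f g g' : X → Matrix n n ℂ) : trForm f (g + g') = trForm f g + trForm f g' := by
  unfold trForm
  rw [← Finset.sum_add_distrib]
  exact Finset.sum_congr rfl fun x _ => trPair_add_right _ _ _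

omit [DecidableEq n] in
/-- Real homogeneity in the first argument. [cite: Balaban1985Variational, (85) p.291] -/
theorem trForm_smul_left (r : ℝ) (f g : X → Matrix n n ℂ) : trForm (r • f) g = r * trForm f g := by
  unfold trForm
  rw [Finset.mul_sum]
  exact Finset.sum_congr rfl fun x _ => trPair_smul_left r _ _

omit [DecidableEq n] in
/-- Real homogeneity in the second argument. [cite: Balaban1985Variational, (85) p.291] -/
theorem trForm_smul_right (r : ℝ) (f g : X → Matrix n n ℂ) : trForm f (r • g) = r * trForm f g := by
  unfold trForm
  rw [Finset.mul_sum]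
  exact Finset.sum_congr rfl fun x _ => trPair_smul_right r _ _

omit [DecidableEq n] in
/-- `trForm 0 g = 0`. [cite: Balaban1985Variational, (85) p.291] -/
theorem trForm_zero_left (g : X → Matrix n n ℂ) : trForm 0 g = 0 := by
  unfold trForm
  exact Finset.sum_eq_zero fun x _ => trPair_zero_left _

variable [DecidableEq X]

omit [DecidableEq n] in
/-- Pairing with a configuration supported at one bond: `trForm (δ_x m) g = Re Tr mᴴg(x)`. [cite: Balaban1985Variational, (85) p.291] -/
theorem trForm_single_left (x : X) (m : Matrix n n ℂ) (g : X → Matrix n n ℂ) :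
    trForm (Pi.single x m) g = trPair m (g x) := by
  unfold trForm
  rw [Finset.sum_eq_single x]
  · rw [Pi.single_eq_same]
  · intro x' _ hx'
    rw [Pi.single_eq_of_ne hx', trPair_zero_left]
  · intro h; exact absurd (Finset.mem_univ x) h

omit [DecidableEq n] [DecidableEq X] in
/-- `f ↦ trForm f g` as an `ℝ`-linear functional. [cite: Balaban1985Variational, (85) p.291] -/
def trFormLeft (g : X → Matrix n n ℂ) : (X → Matrix n n ℂ) →ₗ[ℝ] ℝ where
  toFun f := trForm f g
  map_add' f f' := trForm_add_left f f' g
  map_smul' r f := trForm_smul_left r f g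

omit [DecidableEq n] [DecidableEq X] in
/-- Unfolding. [cite: Balaban1985Variational, (85) p.291] -/
@[simp] theorem trFormLeft_apply (g f : X → Matrix n n ℂ) : trFormLeft g f = trForm f g := rfl

end Form

/-! ## §3  The transpose of a real-linear operator on matrix-valued configurations -/

section Transpose

variable {X Y : Type} [DecidableEq X] [Fintype Y]

/-- **THE TRANSPOSE** of an `ℝ`-linear operator `T` from `X`-configurations to `Y`-configurations of `N × N` complex matrices,
for the trace forms: entrywise `(Tᵗw)(x)_{ij} = ⟨T(δ_x E_{ij}), w⟩ + i·⟨T(δ_x iE_{ij}), w⟩` (the real and imaginary parts read off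
the two real directions of the matrix unit `E_{ij}` — `T` is only `ℝ`-linear). [cite: Balaban1985Variational, (88) p.291] -/
def transposeOf (T : (X → Matrix n n ℂ) →ₗ[ℝ] (Y → Matrix n n ℂ)) : (Y → Matrix n n ℂ) →ₗ[ℝ] (X → Matrix n n ℂ) where
  toFun w x := Matrix.of fun i j =>
    ((trForm (T (Pi.single x (Matrix.single i j (1 : ℂ)))) w : ℝ) : ℂ) +
      ((trForm (T (Pi.single x (Matrix.single i j Complex.I))) w : ℝ) : ℂ) * Complex.I
  map_add' w w' := by
    funext x
    ext i j
    simp only [Matrix.of_apply, Pi.add_apply, Matrix.add_apply, trForm_add_right, Complex.ofReal_add]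
    ring
  map_smul' r w := by
    funext x
    ext i j
    simp only [Matrix.of_apply, Pi.smul_apply, Matrix.smul_apply, trForm_smul_right, Complex.ofReal_mul,
      RingHom.id_apply, Complex.real_smul]
    ring

/-- Unfolding an entry of the transpose. [cite: Balaban1985Variational, (88) p.291] -/
theorem transposeOf_apply (T : (X → Matrix n n ℂ) →ₗ[ℝ] (Y → Matrix n n ℂ)) (w : Y → Matrix n n ℂ) (x : X) (i j : n) :
    transposeOf T w x i j =
      ((trForm (T (Pi.single x (Matrix.single i j (1 : ℂ)))) w : ℝ) : ℂ) +
        ((trForm (T (Pi.single x (Matrix.single i j Complex.I))) w : ℝ) : ℂ) * Complex.I := rfl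

/-- `transposeOf` is additive in the operator. [cite: Balaban1985Variational, (88) p.291] -/
theorem transposeOf_add (T T' : (X → Matrix n n ℂ) →ₗ[ℝ] (Y → Matrix n n ℂ)) :
    transposeOf (T + T') = transposeOf T + transposeOf T' := by
  apply LinearMap.ext
  intro w
  funext x
  ext i j
  simp only [LinearMap.add_apply, Pi.add_apply, Matrix.add_apply, transposeOf_apply, trForm_add_left, Complex.ofReal_add]
  ring

/-- `transposeOf` is `ℝ`-homogeneous in the operator. [cite: Balaban1985Variational, (88) p.291] -/
theorem transposeOf_smul (r : ℝ) (T : (X → Matrix n n ℂ) →ₗ[ℝ] (Y → Matrix n n ℂ)) :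
    transposeOf (r • T) = r • transposeOf T := by
  apply LinearMap.ext
  intro w
  funext x
  ext i j
  simp only [LinearMap.smul_apply, Pi.smul_apply, Matrix.smul_apply, transposeOf_apply, trForm_smul_left,
    Complex.ofReal_mul, Complex.real_smul]
  ring

variable {FA : Type} [AddCommGroup FA] [Module ℝ FA]

/-- **THE TRANSPOSED FAMILY** `𝔄 ↦ (Φ𝔄)ᵗ` of an `𝔄`-dependent family (the shape of `δ𝔇(A′)[𝔄] ↦ δ𝔇*[𝔄]`), linear in `𝔄`.
[cite: Balaban1985Variational, (88) p.291] -/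
def transposeOf₂ (Φ : FA →ₗ[ℝ] (X → Matrix n n ℂ) →ₗ[ℝ] (Y → Matrix n n ℂ)) :
    FA →ₗ[ℝ] (Y → Matrix n n ℂ) →ₗ[ℝ] (X → Matrix n n ℂ) where
  toFun v := transposeOf (Φ v)
  map_add' v v' := by rw [map_add, transposeOf_add]
  map_smul' r v := by rw [map_smul, transposeOf_smul, RingHom.id_apply]

/-- Unfolding. [cite: Balaban1985Variational, (88) p.291] -/
@[simp] theorem transposeOf₂_apply (Φ : FA →ₗ[ℝ] (X → Matrix n n ℂ) →ₗ[ℝ] (Y → Matrix n n ℂ)) (v : FA) :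
    transposeOf₂ Φ v = transposeOf (Φ v) := rfl

end Transpose

end

end Literature.MathematicalPhysics.QuantumFieldTheory.Balaban1983to89.B11TracePairing
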